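import Mathlib
import Literature.Analysis.FluidPDE.TypeIICoreWitness
import Literature.Analysis.FluidPDE.ClassicalSolution
import Literature.Analysis.FluidPDE.ClassicalSolutionCalculus
import Literature.Analysis.FluidPDE.NSCriticalClosureBesovKatoClass
import Literature.Analysis.FluidPDE.KatoFarFieldBound
import Literature.Analysis.FluidPDE.NSLerayBlowupRateTopHolds
import Literature.Analysis.FluidPDE.NSCriticalClosureProofs
import Literature.Analysis.FluidPDE.TaoLocalisationHolds
import Literature.Analysis.FluidPDE.ClassicalTopPointRegularity
import HarnessLib

/-!
# Cruxes `ColumnarCoreExclusion` (stmt-1966) / `MonopoleCoreExclusion` (stmt-1965): the anchor stubs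
# REDUCED — common anchoring and the singular anchor are free once the witnesses are late with a
# core-radius floor

`--supports stmt-NavierStokesRegularity-1966` (helper file; theorems only, no definitions, no `sorry`).

The registered anchor stubs `stub_anchoredLateColumnarWitness` (line `columnar_comparison_flow`, 1966) and
`stub_anchoredLateAxisymWitness` (line `axisymmetric_comparison_flow`, 1965) conclude, from the crux hypotheses
(maximal smooth Leray–Hopf solution `u` on `[0,T)` from a rapidly decaying datum, core witnesses of the class at
every level frequently before `T`), that there is a point `xs` SINGULAR at time `T` and, for every level `K > 0`,
a level-`K` witness `(t, x₀, L, V, Q, W)` which is LATE, `(T - t)·V ≤ K·L`, and ANCHORED at `xs`,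
`dist xs x₀ ≤ K·L/4`.  Two pieces of this are not in the crux hypothesis `hw` (census of hands 6-g0/6-g1 and of
this hand): lateness (the Type-I ratio `(T-t)V²/ν` at the witness times is uncontrolled for a non-Type-I
blow-up) and a floor on the core radius `R = K·L` (which may shrink faster than the near-maximum points approach
the singular set).  THIS FILE PROVES THAT NOTHING ELSE IS MISSING: for any profile class `C` stable under the
dilations `W ↦ W(c·)`, `c ≥ 1` (both `IsColumnar` and `IsAxisymmetric` are), if class-`C` witnesses occur at every
level frequently before `T`, LATE and with a CORE-RADIUS FLOOR `r₀ ≤ K·L`, then the full conclusion of the anchor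
stub holds — a singular anchor `xs` and anchored late level-`K` witnesses for every `K > 0`
(`anchoredLateWitness_of_lateWitnesses_radiusFloor`; the columnar / axisymmetric specialisations, in the binder
shape of the two stubs, are the companion files `…CoreExclusionAnchorReductionColumnar`,
`…CoreExclusionAnchorReductionAxisym`).

Proof (all inputs are theorems of the tree).  (1) Leray's lower rate (`leray_blowup_rate_top_holds`, sub-strip
boundedness from `eLpNorm_uncurry_top_lt_top_of_tao2011`): a speed bound `V` at time `t` has
`V ≥ c₀√ν/√(T-t)`, so witnesses requested after `T - c₀²ν/(n+1)²` have `V ≥ n+1`.  (2) The Kato far-field bound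
(`isKatoSolutionOn_of_classical`, `IsKatoSolutionOn.farField_bound_holds`, made pointwise by continuity): `u` is
bounded by `M` on `(T-δ, T) × {‖x‖ > R}`, so the near-maximum points `x₁ⁿ` (`‖u(tₙ,x₁ⁿ)‖ ≥ Vₙ/2 > M`) lie in
`B̄(0,R)`; Bolzano–Weierstrass gives a cluster point `xs`.  (3) `xs` is singular: a bound on
`(T-ρ², T) × B_ρ(xs)` would bound `Vₙ ≤ 2‖u(tₙ,x₁ⁿ)‖` along the subsequence, against `Vₙ → ∞`.  (4) Anchoring:
along the subsequence `dist(x₁ⁿ, xs) ≤ r₀/8 ≤ KₙLₙ/8` and `dist(x₁ⁿ, x₀ⁿ) ≤ Lₙ ≤ KₙLₙ/8` (`Kₙ ≥ 8`).  (5) Every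
lower level `K ≤ Kₙ` is served by the same slice with `L' = (Kₙ/K)Lₙ`, `W' = W((Kₙ/K)·)`, which keeps the core
radius `K L' = KₙLₙ`, hence lateness and anchoring (`lateAnchoredWitness_of_level_le`).

What remains research for the two anchor stubs is therefore exactly: LATENESS with a CORE-RADIUS FLOOR of the
class witnesses.  Nothing about Navier–Stokes regularity is claimed; no crux is proved here.
-/

noncomputable section

open Set Metric MeasureTheory Function Filter Topology
open Literature.Analysis Literature.Analysis.FluidPDE
open scoped ENNReal

namespace Summit.NavierStokesRegularity.NavierStokesRegularity.Theorems

-- the problem directory repeats the summit name (`NavierStokesRegularity/NavierStokesRegularity`)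
set_option linter.dupNamespace false

namespace CoreExclusionAnchor

/-! ### §1 Level rescaling of a late anchored witness -/

/-- **Lower levels are free for late anchored witnesses.**  If the slice `u t` carries a level-`K'` witness
`(x₀, L, V, Q, W)` of a dilation-stable class `C` which is late (`(T-t)V ≤ K'L`) and anchored at `xs`
(`dist xs x₀ ≤ K'L/4`), then for every `0 < K ≤ K'` it carries a level-`K` witness with the same centre, speed
bound and frame, core length `L' = (K'/K)·L` and profile `W' = W((K'/K)·)`; the core radius `K·L' = K'·L` is
unchanged, so the new witness is again late and anchored at `xs`. [folklore] -/
theorem lateAnchoredWitness_of_level_le {C : (EuclideanSpace ℝ (Fin 3) → EuclideanSpace ℝ (Fin 3)) → Prop}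
    (hC : ∀ W, C W → ∀ c : ℝ, 1 ≤ c → C (fun y => W (c • y)))
    {ν K K' T t L V : ℝ} {u : ℝ → EuclideanSpace ℝ (Fin 3) → EuclideanSpace ℝ (Fin 3)}
    {xs x₀ : EuclideanSpace ℝ (Fin 3)}
    {Q : EuclideanSpace ℝ (Fin 3) ≃ₗᵢ[ℝ] EuclideanSpace ℝ (Fin 3)}
    {W : EuclideanSpace ℝ (Fin 3) → EuclideanSpace ℝ (Fin 3)}
    (hν : 0 ≤ ν) (hK : 0 < K) (hKK' : K ≤ K') (hL : 0 < L) (hV : 0 < V) (hW : C W)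
    (hnear : ∃ x₁, dist x₁ x₀ ≤ L ∧ V ≤ 2 * ‖u t x₁‖)
    (hosc : ∃ y y' : EuclideanSpace ℝ (Fin 3), ‖y‖ ≤ 1 ∧ ‖y'‖ ≤ 1 ∧ (4 : ℝ)⁻¹ ≤ ‖W y - W y'‖)
    (hRe : K' * ν ≤ L * V)
    (hclose : ∀ y : EuclideanSpace ℝ (Fin 3), ‖y‖ ≤ K' →
      ‖V⁻¹ • Q.symm (u t (x₀ + L • Q y)) - W y‖ ≤ K'⁻¹)
    (hlate : (T - t) * V ≤ K' * L) (hdist : dist xs x₀ ≤ K' * L / 4) :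
    ∃ (L' : ℝ) (W' : EuclideanSpace ℝ (Fin 3) → EuclideanSpace ℝ (Fin 3)),
      0 < L' ∧ C W' ∧
      (∃ x₁, dist x₁ x₀ ≤ L' ∧ V ≤ 2 * ‖u t x₁‖) ∧
      (∃ y y' : EuclideanSpace ℝ (Fin 3), ‖y‖ ≤ 1 ∧ ‖y'‖ ≤ 1 ∧ (4 : ℝ)⁻¹ ≤ ‖W' y - W' y'‖) ∧
      K * ν ≤ L' * V ∧
      (∀ y : EuclideanSpace ℝ (Fin 3), ‖y‖ ≤ K →
        ‖V⁻¹ • Q.symm (u t (x₀ + L' • Q y)) - W' y‖ ≤ K⁻¹) ∧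
      (T - t) * V ≤ K * L' ∧ dist xs x₀ ≤ K * L' / 4 := by
  have hK' : 0 < K' := hK.trans_le hKK'
  set c : ℝ := K' / K with hc
  have hc1 : 1 ≤ c := by rw [hc, le_div_iff₀ hK, one_mul]; exact hKK'
  have hc0 : 0 < c := one_pos.trans_le hc1
  have hKL : K * (c * L) = K' * L := by rw [hc]; field_simp
  refine ⟨c * L, fun y => W (c • y), by positivity, hC W hW c hc1, ?_, ?_, ?_, ?_, ?_, ?_⟩
  · obtain ⟨x₁, hx₁, hVx₁⟩ := hnear
    exact ⟨x₁, hx₁.trans (le_mul_of_one_le_left hL.le hc1), hVx₁⟩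
  · obtain ⟨y, y', hy, hy', hW⟩ := hosc
    have hinv : c⁻¹ ≤ 1 := inv_le_one_of_one_le₀ hc1
    have hn : ∀ z : EuclideanSpace ℝ (Fin 3), ‖z‖ ≤ 1 → ‖c⁻¹ • z‖ ≤ 1 := fun z hz => by
      rw [norm_smul, Real.norm_of_nonneg (inv_nonneg.2 hc0.le)]
      exact (mul_le_mul hinv hz (norm_nonneg _) zero_le_one).trans_eq (one_mul 1)
    refine ⟨c⁻¹ • y, c⁻¹ • y', hn y hy, hn y' hy', ?_⟩
    simpa only [smul_smul, mul_inv_cancel₀ hc0.ne', one_smul] using hW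
  · calc K * ν ≤ K' * ν := mul_le_mul_of_nonneg_right hKK' hν
      _ ≤ L * V := hRe
      _ ≤ c * L * V := by
        rw [mul_assoc]; exact le_mul_of_one_le_left (mul_nonneg hL.le hV.le) hc1
  · intro y hy
    have hy' : ‖c • y‖ ≤ K' := by
      rw [norm_smul, Real.norm_of_nonneg hc0.le]
      calc c * ‖y‖ ≤ c * K := mul_le_mul_of_nonneg_left hy hc0.le
        _ = K' := by rw [hc]; field_simp
    have h := hclose (c • y) hy'
    have harg : x₀ + L • Q (c • y) = x₀ + (c * L) • Q y := by
      rw [Q.map_smul, smul_smul, mul_comm L c]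
    rw [harg] at h
    exact h.trans (inv_anti₀ hK hKK')
  · rw [hKL]; exact hlate
  · rw [hKL]; exact hdist

/-! ### §2 Leray's lower rate for a speed bound; the far field made pointwise -/

/-- **Leray's rate in speed-bound form** (Leray 1934 §19 (3.9), the tree theorem `leray_blowup_rate_top_holds`;
sub-strip boundedness from Tao 2013 Cor. 11.1, `eLpNorm_uncurry_top_lt_top_of_tao2011`): for a maximal smooth
Leray–Hopf solution from a rapidly decaying datum there is `c₀ > 0` such that every everywhere-bound `V` of the
speed at a time `t ∈ [0,T)` satisfies `c₀ √ν / √(T - t) ≤ V`. [cite: Leray1934, §19 (3.8)–(3.9) p. 224] -/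
theorem exists_leray_const_of_speedBound {ν T : ℝ}
    {u : ℝ → EuclideanSpace ℝ (Fin 3) → EuclideanSpace ℝ (Fin 3)} {p : ℝ → EuclideanSpace ℝ (Fin 3) → ℝ}
    (hν : 0 < ν) (hT : 0 < T) (hmax : IsMaximalSmoothSolution ν 0 u p T)
    (hLH : IsLerayHopfOn T ν 0 (u 0) u) (hdec : HasRapidSpatialDecay (u 0)) :
    ∃ c₀ : ℝ, 0 < c₀ ∧ ∀ t ∈ Ico 0 T, ∀ V : ℝ, (∀ x, ‖u t x‖ ≤ V) →
      c₀ * Real.sqrt ν / Real.sqrt (T - t) ≤ V := by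
  obtain ⟨c, hc, hrate⟩ := leray_blowup_rate_top_holds
  have hbdd : ∀ T' ∈ Ioo 0 T, eLpNorm (uncurry u) ⊤
      ((volume : Measure (ℝ × EuclideanSpace ℝ (Fin 3))).restrict (Icc 0 T' ×ˢ univ)) < ⊤ :=
    eLpNorm_uncurry_top_lt_top_of_tao2011 tao2011_hasBoundedSobolevNormsOn_holds hν hmax.1 hLH hdec
  have hr := hrate ν T hν hT u p hmax hLH hbdd
  refine ⟨c, hc, fun t ht V hV => ?_⟩
  have hV0 : 0 ≤ V := (norm_nonneg _).trans (hV 0)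
  have h2 : eLpNorm (u t) ⊤ volume ≤ ENNReal.ofReal V := by
    rw [eLpNorm_exponent_top]
    exact eLpNormEssSup_le_of_ae_bound (Eventually.of_forall hV)
  exact (ENNReal.ofReal_le_ofReal_iff hV0).1 ((hr t ht).trans h2)

/-- **The far field of a blowing-up classical solution is bounded, pointwise** (Rusin–Šverák 2011 §4; Lemarié-Rieusset
2016 Thm. 15.1 (C): the tree theorems `isKatoSolutionOn_of_classical` and `IsKatoSolutionOn.farField_bound_holds`,
made pointwise by continuity of the classical velocity on the open far-field slab): there are `δ > 0`, `R`, `M`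
with `‖u(s,x)‖ ≤ M` whenever `T - δ < s`, `0 < s < T` and `R < ‖x‖`. [cite: RusinSverak2011, §4 p. 6] -/
theorem exists_farField_norm_le {ν T : ℝ}
    {u : ℝ → EuclideanSpace ℝ (Fin 3) → EuclideanSpace ℝ (Fin 3)} {p : ℝ → EuclideanSpace ℝ (Fin 3) → ℝ}
    (hν : 0 < ν) (hT : 0 < T) (hsol : IsClassicalNSSolutionOn (Ico 0 T) ν 0 u p)
    (hLH : IsLerayHopfOn T ν 0 (u 0) u) (hdec : HasRapidSpatialDecay (u 0)) :
    ∃ δ R M : ℝ, 0 < δ ∧ ∀ s : ℝ, T - δ < s → 0 < s → s < T →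
      ∀ x : EuclideanSpace ℝ (Fin 3), R < ‖x‖ → ‖u s x‖ ≤ M := by
  have hK := isKatoSolutionOn_of_classical hν hT hsol hLH hdec
  obtain ⟨δ, hδ, R, hfar⟩ := IsKatoSolutionOn.farField_bound_holds hν hT hK
  -- the open far-field slab inside `(0, T) × ℝ³`
  set U : Set (ℝ × EuclideanSpace ℝ (Fin 3)) :=
    Ioo (max (T - δ) 0) T ×ˢ (closedBall (0 : EuclideanSpace ℝ (Fin 3)) R)ᶜ with hU
  have hUo : IsOpen U := isOpen_Ioo.prod isClosed_closedBall.isOpen_compl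
  have hUsub : U ⊆ Ioo (T - δ) T ×ˢ (closedBall (0 : EuclideanSpace ℝ (Fin 3)) R)ᶜ :=
    prod_mono (Ioo_subset_Ioo_left (le_max_left _ _)) subset_rfl
  have hUsub' : U ⊆ Ico 0 T ×ˢ (univ : Set (EuclideanSpace ℝ (Fin 3))) := by
    rintro ⟨s, x⟩ ⟨hs, -⟩
    exact ⟨⟨((le_max_right _ _).trans_lt hs.1).le, hs.2⟩, mem_univ _⟩
  have hcont : ContinuousOn (uncurry u) U := (hsol.smooth_velocity.continuousOn).mono hUsub'
  have hfin : eLpNorm (uncurry u) ⊤ ((volume : Measure (ℝ × EuclideanSpace ℝ (Fin 3))).restrict U) < ⊤ :=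
    (eLpNorm_mono_measure _ (Measure.restrict_mono hUsub le_rfl)).trans_lt hfar
  set M : ℝ := (eLpNorm (uncurry u) ⊤ ((volume : Measure (ℝ × EuclideanSpace ℝ (Fin 3))).restrict U)).toReal
  refine ⟨δ, R, M, hδ, fun s hs1 hs2 hs3 x hx => ?_⟩
  have hmem : (s, x) ∈ U := by
    refine ⟨⟨max_lt hs1 hs2, hs3⟩, ?_⟩
    rw [mem_compl_iff, mem_closedBall, dist_zero_right, not_le]
    exact hx
  exact exists_forall_norm_le_of_eLpNorm_top_lt_top hUo hcont hfin (s, x) hmem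

/-! ### §3 The reduction of the anchor stubs -/

/-- **Anchored late witnesses from late witnesses with a core-radius floor** (class-generic; the deterministic half
of the registered anchor stubs of cruxes `ColumnarCoreExclusion` / `MonopoleCoreExclusion`).  Let `C` be a profile
class stable under dilations `W ↦ W(c·)`, `c ≥ 1`.  Let `(u,p)` be a maximal smooth solution on `[0,T)`,
Leray–Hopf from its rapidly decaying datum, and assume: for some `r₀ > 0`, at every level `K > 0` and after every
`t₀ < T` there is a time `t ∈ (t₀,T)` at which `u t` carries a level-`K` witness `(x₀,L,V,Q,W)` of class `C`
which is LATE, `(T-t)V ≤ KL`, with CORE RADIUS `KL ≥ r₀`.  Then there is a point `xs`, singular at time `T` (no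
bound on any `(T-ρ²,T) × B_ρ(xs)`), such that for every `K > 0` some late level-`K` witness of class `C` at a time
`0 < t < T` is anchored at `xs`: `dist xs x₀ ≤ KL/4`.  (Leray's rate ⇒ `V → ∞` along the requested times; Kato
far-field bound ⇒ the near-maximum points stay in a ball; Bolzano–Weierstrass ⇒ a cluster point, which is singular;
anchoring along the subsequence; lower levels by `lateAnchoredWitness_of_level_le`.) [folklore] -/
theorem anchoredLateWitness_of_lateWitnesses_radiusFloor
    {C : (EuclideanSpace ℝ (Fin 3) → EuclideanSpace ℝ (Fin 3)) → Prop}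
    (hC : ∀ W, C W → ∀ c : ℝ, 1 ≤ c → C (fun y => W (c • y)))
    {ν T : ℝ} {u : ℝ → EuclideanSpace ℝ (Fin 3) → EuclideanSpace ℝ (Fin 3)}
    {p : ℝ → EuclideanSpace ℝ (Fin 3) → ℝ}
    (hν : 0 < ν) (hT : 0 < T) (hmax : IsMaximalSmoothSolution ν 0 u p T)
    (hLH : IsLerayHopfOn T ν 0 (u 0) u) (hdec : HasRapidSpatialDecay (u 0))
    (hwl : ∃ r₀ : ℝ, 0 < r₀ ∧ ∀ K : ℝ, 0 < K → ∀ t₀ < T, ∃ t, t₀ < t ∧ t < T ∧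
      ∃ (x₀ : EuclideanSpace ℝ (Fin 3)) (L V : ℝ)
        (Q : EuclideanSpace ℝ (Fin 3) ≃ₗᵢ[ℝ] EuclideanSpace ℝ (Fin 3))
        (W : EuclideanSpace ℝ (Fin 3) → EuclideanSpace ℝ (Fin 3)),
        0 < L ∧ 0 < V ∧ C W ∧ (∀ x, ‖u t x‖ ≤ V) ∧
        (∃ x₁, dist x₁ x₀ ≤ L ∧ V ≤ 2 * ‖u t x₁‖) ∧
        (∃ y y' : EuclideanSpace ℝ (Fin 3), ‖y‖ ≤ 1 ∧ ‖y'‖ ≤ 1 ∧ (4 : ℝ)⁻¹ ≤ ‖W y - W y'‖) ∧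
        K * ν ≤ L * V ∧
        (∀ y : EuclideanSpace ℝ (Fin 3), ‖y‖ ≤ K →
          ‖V⁻¹ • Q.symm (u t (x₀ + L • Q y)) - W y‖ ≤ K⁻¹) ∧
        (T - t) * V ≤ K * L ∧ r₀ ≤ K * L) :
    ∃ xs : EuclideanSpace ℝ (Fin 3),
      (¬ ∃ ρ M : ℝ, 0 < ρ ∧ ∀ s ∈ Ioo (T - ρ ^ 2) T, ∀ x ∈ ball xs ρ, ‖u s x‖ ≤ M) ∧
      ∀ K : ℝ, 0 < K → ∃ t : ℝ, 0 < t ∧ t < T ∧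
        ∃ (x₀ : EuclideanSpace ℝ (Fin 3)) (L V : ℝ)
          (Q : EuclideanSpace ℝ (Fin 3) ≃ₗᵢ[ℝ] EuclideanSpace ℝ (Fin 3))
          (W : EuclideanSpace ℝ (Fin 3) → EuclideanSpace ℝ (Fin 3)),
          0 < L ∧ 0 < V ∧ C W ∧ (∀ x, ‖u t x‖ ≤ V) ∧
          (∃ x₁, dist x₁ x₀ ≤ L ∧ V ≤ 2 * ‖u t x₁‖) ∧
          (∃ y y' : EuclideanSpace ℝ (Fin 3), ‖y‖ ≤ 1 ∧ ‖y'‖ ≤ 1 ∧ (4 : ℝ)⁻¹ ≤ ‖W y - W y'‖) ∧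
          K * ν ≤ L * V ∧
          (∀ y : EuclideanSpace ℝ (Fin 3), ‖y‖ ≤ K →
            ‖V⁻¹ • Q.symm (u t (x₀ + L • Q y)) - W y‖ ≤ K⁻¹) ∧
          (T - t) * V ≤ K * L ∧ dist xs x₀ ≤ K * L / 4 := by
  -- Leray's constant and the far field
  obtain ⟨c₀, hc₀, hleray⟩ := exists_leray_const_of_speedBound hν hT hmax hLH hdec
  obtain ⟨δ, R, M, hδ, hfar⟩ := exists_farField_norm_le hν hT hmax.1 hLH hdec
  obtain ⟨r₀, hr₀, hsel⟩ := hwl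
  -- the requested levels `n + 8` and starting times
  set ε : ℕ → ℝ := fun n => c₀ ^ 2 * ν / ((n : ℝ) + 1) ^ 2 with hε
  have hεpos : ∀ n, 0 < ε n := fun n => by simp only [hε]; positivity
  set t₀ : ℕ → ℝ := fun n => max (max (T / 2) (T - δ)) (T - ε n) with ht₀
  have ht₀T : ∀ n, t₀ n < T := fun n =>
    max_lt (max_lt (by linarith) (by linarith)) (by linarith [hεpos n])
  have hsel' : ∀ n : ℕ, ∃ t, t₀ n < t ∧ t < T ∧
      ∃ (x₀ : EuclideanSpace ℝ (Fin 3)) (L V : ℝ)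
        (Q : EuclideanSpace ℝ (Fin 3) ≃ₗᵢ[ℝ] EuclideanSpace ℝ (Fin 3))
        (W : EuclideanSpace ℝ (Fin 3) → EuclideanSpace ℝ (Fin 3)),
        0 < L ∧ 0 < V ∧ C W ∧ (∀ x, ‖u t x‖ ≤ V) ∧
        (∃ x₁, dist x₁ x₀ ≤ L ∧ V ≤ 2 * ‖u t x₁‖) ∧
        (∃ y y' : EuclideanSpace ℝ (Fin 3), ‖y‖ ≤ 1 ∧ ‖y'‖ ≤ 1 ∧ (4 : ℝ)⁻¹ ≤ ‖W y - W y'‖) ∧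
        ((n : ℝ) + 8) * ν ≤ L * V ∧
        (∀ y : EuclideanSpace ℝ (Fin 3), ‖y‖ ≤ (n : ℝ) + 8 →
          ‖V⁻¹ • Q.symm (u t (x₀ + L • Q y)) - W y‖ ≤ ((n : ℝ) + 8)⁻¹) ∧
        (T - t) * V ≤ ((n : ℝ) + 8) * L ∧ r₀ ≤ ((n : ℝ) + 8) * L :=
    fun n => hsel ((n : ℝ) + 8) (by positivity) (t₀ n) (ht₀T n)
  choose t ht₀t htT x₀ L V Q W hL hV hCW hbd hnear hosc hRe hclose hlate hfloor using hsel'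
  choose x₁ hx₁ hVx₁ using hnear
  -- elementary consequences
  have ht_pos : ∀ n : ℕ, 0 < t n := fun n => by
    have h1 : T / 2 ≤ t₀ n := (le_max_left _ _).trans (le_max_left _ _)
    linarith [ht₀t n]
  have ht_far : ∀ n : ℕ, T - δ < t n := fun n =>
    ((le_max_right _ _).trans (le_max_left _ _)).trans_lt (ht₀t n)
  have ht_late : ∀ n : ℕ, T - t n < ε n := fun n => by
    have h1 : T - ε n ≤ t₀ n := le_max_right _ _
    linarith [ht₀t n]
  -- Leray: `V n ≥ n + 1`
  have hVge : ∀ n : ℕ, (n : ℝ) + 1 ≤ V n := by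
    intro n
    have hTt : 0 < T - t n := sub_pos.2 (htT n)
    have h1 := hleray (t n) ⟨(ht_pos n).le, htT n⟩ (V n) (hbd n)
    have hsq : Real.sqrt (T - t n) ≤ c₀ * Real.sqrt ν / ((n : ℝ) + 1) := by
      have h2 : T - t n ≤ (c₀ * Real.sqrt ν / ((n : ℝ) + 1)) ^ 2 := by
        rw [div_pow, mul_pow, Real.sq_sqrt hν.le]
        exact (ht_late n).le
      calc Real.sqrt (T - t n) ≤ Real.sqrt ((c₀ * Real.sqrt ν / ((n : ℝ) + 1)) ^ 2) :=
            Real.sqrt_le_sqrt h2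
        _ = c₀ * Real.sqrt ν / ((n : ℝ) + 1) := Real.sqrt_sq (by positivity)
    have hpos : 0 < Real.sqrt (T - t n) := Real.sqrt_pos.2 hTt
    have hnum : 0 < c₀ * Real.sqrt ν := mul_pos hc₀ (Real.sqrt_pos.2 hν)
    calc (n : ℝ) + 1 = c₀ * Real.sqrt ν / (c₀ * Real.sqrt ν / ((n : ℝ) + 1)) := by
          field_simp
      _ ≤ c₀ * Real.sqrt ν / Real.sqrt (T - t n) := div_le_div_of_nonneg_left hnum.le hpos hsq
      _ ≤ V n := h1
  -- far field: the near-maximum points stay in `B̄(0, R)` once `V n > 2 M`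
  have hx₁R : ∀ n : ℕ, 2 * M < V n → x₁ n ∈ closedBall (0 : EuclideanSpace ℝ (Fin 3)) R := by
    intro n hn
    rw [mem_closedBall, dist_zero_right]
    by_contra hx
    push Not at hx
    have h := hfar (t n) (ht_far n) (ht_pos n) (htT n) (x₁ n) hx
    linarith [hVx₁ n]
  obtain ⟨N₁, hN₁⟩ := exists_nat_gt (2 * M)
  have hfreq : ∃ᶠ n in atTop, x₁ n ∈ closedBall (0 : EuclideanSpace ℝ (Fin 3)) R := by
    refine (eventually_atTop.2 ⟨N₁, fun n hn => hx₁R n ?_⟩).frequently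
    calc 2 * M < (N₁ : ℝ) := hN₁
      _ ≤ (n : ℝ) := by exact_mod_cast hn
      _ ≤ (n : ℝ) + 1 := by linarith
      _ ≤ V n := hVge n
  -- Bolzano–Weierstrass
  obtain ⟨xs, -, φ, hφ, hlim⟩ := tendsto_subseq_of_frequently_bounded isBounded_closedBall hfreq
  have hφge : ∀ k : ℕ, k ≤ φ k := fun k => hφ.id_le k
  have hVφ : ∀ k : ℕ, (k : ℝ) + 1 ≤ V (φ k) := fun k =>
    le_trans (by exact_mod_cast Nat.add_le_add_right (hφge k) 1) (hVge (φ k))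
  have hεφ : ∀ k : ℕ, T - t (φ k) < c₀ ^ 2 * ν / ((k : ℝ) + 1) := by
    intro k
    refine (ht_late (φ k)).trans_le ?_
    simp only [hε]
    have hk1 : (k : ℝ) + 1 ≤ (φ k : ℝ) + 1 := by exact_mod_cast Nat.add_le_add_right (hφge k) 1
    have hk0 : 0 < (k : ℝ) + 1 := by positivity
    calc c₀ ^ 2 * ν / ((φ k : ℝ) + 1) ^ 2 ≤ c₀ ^ 2 * ν / ((k : ℝ) + 1) ^ 2 :=
          div_le_div_of_nonneg_left (by positivity) (by positivity) (pow_le_pow_left₀ hk0.le hk1 2)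
      _ ≤ c₀ ^ 2 * ν / ((k : ℝ) + 1) := by
          refine div_le_div_of_nonneg_left (by positivity) hk0 ?_
          nlinarith
  have hdistε : ∀ η : ℝ, 0 < η → ∀ᶠ k in atTop, dist (x₁ (φ k)) xs < η := fun η hη =>
    Metric.tendsto_nhds.1 hlim η hη
  refine ⟨xs, ?_, fun K hK => ?_⟩
  · -- `xs` is singular
    rintro ⟨ρ, Mρ, hρ, hbound⟩
    obtain ⟨N₂, hN₂⟩ := exists_nat_gt (c₀ ^ 2 * ν / ρ ^ 2)
    obtain ⟨N₃, hN₃⟩ := exists_nat_gt (2 * Mρ)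
    have e2 : ∀ᶠ k in atTop, T - ρ ^ 2 < t (φ k) := by
      refine eventually_atTop.2 ⟨N₂, fun k hk => ?_⟩
      have hkN : (N₂ : ℝ) ≤ (k : ℝ) := by exact_mod_cast hk
      have hk : c₀ ^ 2 * ν / ρ ^ 2 < (k : ℝ) + 1 := by linarith
      have h1 : c₀ ^ 2 * ν / ((k : ℝ) + 1) < ρ ^ 2 := by
        rw [div_lt_iff₀ (by positivity : (0 : ℝ) < (k : ℝ) + 1)]
        rw [div_lt_iff₀ (by positivity : (0 : ℝ) < ρ ^ 2)] at hk
        linarith [mul_comm (ρ ^ 2) ((k : ℝ) + 1)]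
      linarith [hεφ k]
    have e3 : ∀ᶠ k in atTop, 2 * Mρ < V (φ k) := by
      refine eventually_atTop.2 ⟨N₃, fun k hk => ?_⟩
      calc 2 * Mρ < (N₃ : ℝ) := hN₃
        _ ≤ (k : ℝ) := by exact_mod_cast hk
        _ ≤ (k : ℝ) + 1 := by linarith
        _ ≤ V (φ k) := hVφ k
    obtain ⟨k, hk1, hk2, hk3⟩ := ((hdistε ρ hρ).and (e2.and e3)).exists
    have h := hbound (t (φ k)) ⟨hk2, htT (φ k)⟩ (x₁ (φ k)) (mem_ball.2 hk1)
    linarith [hVx₁ (φ k)]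
  · -- anchored late witnesses at every level
    obtain ⟨N₄, hN₄⟩ := exists_nat_gt K
    have e5 : ∀ᶠ k in atTop, K ≤ (φ k : ℝ) + 8 := by
      refine eventually_atTop.2 ⟨N₄, fun k hk => ?_⟩
      have : (N₄ : ℝ) ≤ (φ k : ℝ) := by exact_mod_cast hk.trans (hφge k)
      linarith
    obtain ⟨k, hk1, hk2⟩ := ((hdistε (r₀ / 8) (by positivity)).and e5).exists
    set n := φ k with hn
    -- anchoring at level `n + 8`
    have hK8 : (8 : ℝ) ≤ (n : ℝ) + 8 := by linarith [(Nat.cast_nonneg n : (0 : ℝ) ≤ n)]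
    have hLn : L n ≤ ((n : ℝ) + 8) * L n / 8 := by
      have := hL n
      nlinarith
    have hanch : dist xs (x₀ n) ≤ ((n : ℝ) + 8) * L n / 4 := by
      calc dist xs (x₀ n) ≤ dist xs (x₁ n) + dist (x₁ n) (x₀ n) := dist_triangle _ _ _
        _ ≤ r₀ / 8 + L n := by rw [dist_comm]; exact add_le_add hk1.le (hx₁ n)
        _ ≤ ((n : ℝ) + 8) * L n / 8 + ((n : ℝ) + 8) * L n / 8 := by
            exact add_le_add (by linarith [hfloor n]) hLn
        _ = ((n : ℝ) + 8) * L n / 4 := by ring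
    -- descend to level `K`
    obtain ⟨L', W', hL', hW', hnear', hosc', hRe', hclose', hlate', hdist'⟩ :=
      lateAnchoredWitness_of_level_le (T := T) hC hν.le hK hk2 (hL n) (hV n) (hCW n)
        ⟨x₁ n, hx₁ n, hVx₁ n⟩ (hosc n) (hRe n) (hclose n) (hlate n) hanch
    exact ⟨t n, ht_pos n, htT n, x₀ n, L', V n, Q n, W', hL', hV n, hW', hbd n, hnear', hosc', hRe',
      hclose', hlate', hdist'⟩

end CoreExclusionAnchor

end Summit.NavierStokesRegularity.NavierStokesRegularity.Theorems

end
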